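import Literature.Geometry.Riemannian.LogarithmicCutoff
import Mathlib.Analysis.Calculus.Deriv.Comp
import Mathlib.Analysis.Calculus.Deriv.Mul
import HarnessLib

/-!
# The even logarithmic cutoff of Bär–Hanke's proof of Thm. 27

Topic `Literature/Geometry/Riemannian` (namespace `Literature.Geometry.Riemannian.BaerHanke`).
A brick (K5e-1 of the notes) of the proof of the named fact
`Literature.Geometry.Riemannian.BarHanke2023_thm27_umbilicNormalForm`. From the logarithmic
cutoff `τ` of `LogarithmicCutoff.lean` (Bär–Hanke 2020, Lemma 2.5 / 2023, proof of Prop. 23: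
`τ ≡ 1` on `(−∞, δε]`, `τ ≡ 0` on `[ε, ∞)`, `|τ̇(r)| ≤ C/(r|log δ|)`, `|τ̈(r)| ≤ C/(r²|log δ|)`)
we form the even cutoff `a(t) = τ(t) τ(−t)` used to interpolate, on the whole line of the
collar coordinate, between the cylinder metric and its `C`-normal Taylor polynomial:

* `exists_evenLogCutoff` — `a` is `C^∞`, `a ≡ 1` on `[−δε, δε]`, `a ≡ 0` on `{|t| ≥ ε}`,
  `0 ≤ a ≤ 1`, and for `t > 0`: `t |ȧ(t)| ≤ C/|log δ|`, `t² |ä(t)| ≤ C/|log δ|`.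

Everything is proved; no definitions, no named facts (D-0026).

## References

* C. Bär, B. Hanke, *Boundary conditions for scalar curvature*, arXiv:2012.09127, §3, proof of
  Prop. 23 and of Thm. 27. [BarHanke2023]
* C. Bär, B. Hanke, *Local flexibility for open partial differential relations*, Comm. Pure
  Appl. Math. 75 (2022), Lemma 2.5. [BarHanke2021]
-/

noncomputable section

open Set Filter Function
open scoped Topology ContDiff

namespace Literature.Geometry.Riemannian

namespace BaerHanke

/-- **The even logarithmic cutoff.** There is `C > 0` such that for `0 < δ < ¼` and `ε > 0`
there is a `C^∞` function `a : ℝ → ℝ` with `a ≡ 1` on `[−δε, δε]`, `a ≡ 0` on `{|t| ≥ ε}`,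
`0 ≤ a ≤ 1`, and `t|ȧ(t)| ≤ C/|log δ|`, `t²|ä(t)| ≤ C/|log δ|` for `t > 0`.
[cite: BarHanke2023, §3, proofs of Prop. 23 and Thm. 27] -/
theorem exists_evenLogCutoff : ∃ C : ℝ, 0 < C ∧ ∀ δ ε : ℝ, 0 < δ → δ < 1 / 4 → 0 < ε →
    ∃ a : ℝ → ℝ, ContDiff ℝ ∞ a ∧
      (∀ t, |t| ≤ δ * ε → a t = 1) ∧
      (∀ t, ε ≤ |t| → a t = 0) ∧
      (∀ t, 0 ≤ a t ∧ a t ≤ 1) ∧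
      (∀ t, 0 < t → |deriv a t| * t ≤ C / |Real.log δ| ∧
        |deriv (deriv a) t| * t ^ 2 ≤ C / |Real.log δ|) := by
  obtain ⟨C, hC, hτ⟩ := exists_logCutoff
  refine ⟨C, hC, fun δ ε hδ hδ4 hε ↦ ?_⟩
  obtain ⟨τ, hτs, hτ1, hτ0, hτ01, hτd1, hτd2⟩ := hτ δ ε hδ hδ4 hε
  have hδε : 0 < δ * ε := mul_pos hδ hε
  refine ⟨fun t ↦ τ t * τ (-t), hτs.mul (hτs.comp contDiff_neg), ?_, ?_, ?_, ?_⟩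
  · intro t ht
    show τ t * τ (-t) = 1
    rw [hτ1 t (le_of_abs_le ht), hτ1 (-t) ((neg_le_abs t).trans ht), one_mul]
  · intro t ht
    show τ t * τ (-t) = 0
    rcases le_or_gt 0 t with h0 | h0
    · rw [abs_of_nonneg h0] at ht
      rw [hτ0 t ht, zero_mul]
    · rw [abs_of_neg h0] at ht
      rw [hτ0 (-t) ht, mul_zero]
  · intro t
    exact ⟨mul_nonneg (hτ01 t).1 (hτ01 (-t)).1, mul_le_one₀ (hτ01 t).2 (hτ01 (-t)).1 (hτ01 (-t)).2⟩
  · intro t ht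
    -- on `(0, ∞)` the even cutoff agrees with `τ`
    have hev : ∀ s, 0 < s → (fun t ↦ τ t * τ (-t)) =ᶠ[𝓝 s] τ := fun s hs ↦ by
      filter_upwards [Ioi_mem_nhds hs] with u hu
      have hu' : 0 < u := hu
      rw [hτ1 (-u) (by linarith), mul_one]
    have hd1 : deriv (fun t ↦ τ t * τ (-t)) t = deriv τ t := (hev t ht).deriv_eq
    have hd1' : deriv (fun t ↦ τ t * τ (-t)) =ᶠ[𝓝 t] deriv τ := by
      filter_upwards [Ioi_mem_nhds ht] with u hu
      exact (hev u hu).deriv_eq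
    have hd2 : deriv (deriv (fun t ↦ τ t * τ (-t))) t = deriv (deriv τ) t := hd1'.deriv_eq
    rw [hd1, hd2]
    have hlog : 0 < |Real.log δ| := abs_pos.2 (Real.log_neg hδ (by linarith)).ne
    constructor
    · have h := hτd1 t ht
      calc |deriv τ t| * t ≤ C / (t * |Real.log δ|) * t := by gcongr
        _ = C / |Real.log δ| := by field_simp
    · have h := hτd2 t ht
      calc |deriv (deriv τ) t| * t ^ 2 ≤ C / (t ^ 2 * |Real.log δ|) * t ^ 2 := by gcongr
        _ = C / |Real.log δ| := by field_simp

end BaerHanke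

end Literature.Geometry.Riemannian

end
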